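import Literature.Computability.Cryptography.ChenQuantumLWEAdaptiveNonDemolition

/-!
# Joint processing of several runs: safe operations on the tensor state are class-blind (T4, multi-run form)

REPRODUCTION / ANALYSIS OF A CLAIMED RESULT UNDER ADJUDICATION (withdrawn): Yilei Chen, *Quantum
Algorithms for Lattice Problems*, IACR ePrint 2024/555, version of 2024-04-18 [ChenQuantumLattice2024]
(the version carrying the author's note that Step 9 contains a bug), Step 9 (§3.5.9, pp. 34–38) acting
on the line ket `|φ8.b⟩ = Σ_{j ∈ ℤ_P} e(-j²/P) |2D²j·b + v′ mod N⟩` (p. 35), Claim 3.14 (pp. 33–34) and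
eq. (12) (p. 17); the algorithm is RUN REPEATEDLY (one linear equation (41), p. 38, per run), every
run having the same secret-dependent direction `b` and a FRESH offset `v′`.  Bundle
`papers/QuantumAdvantage/lwe-quantum-autopsy/`, Part 2 (`REPAIR-CENSUS.md` §1 **T4**, §14.1 (β)), sequel
of `ChenQuantumLWEAdaptiveNonDemolition.lean`.
HONEST FRAMING: kernel-checked THEOREMS about states occurring in a WITHDRAWN algorithm — the joint,
multi-register form of a NO-GO for in-run repairs of Step 9, NOT summit progress, no cryptanalytic claim
in either direction, no new algorithm; quantum lower bounds are out of scope.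

## What is proved

The three previous non-demolition modules concern ONE run: a linear operation on the run's register that
never destroys the line ket `|φ_{b,w}⟩` of any instance the algorithm cannot exclude (class secret `b`,
offset `w` in the knowable coset of the true offset) acts on that whole family as ONE scalar
(`IsCosetND.apply_eq_smul`), also adaptively (`AdaptiveSafe.exists_eq_smul`).  The last sentence of the
census's T4 left open in the kernel was the JOINT one (REPAIR-CENSUS §14.1 (β)): an algorithm holding the
registers of `r` runs may apply an ENTANGLING operation to the tensor state
`|φ_{b,w₁}⟩ ⊗ ⋯ ⊗ |φ_{b,w_r}⟩` — common secret `b`, independent offsets `wᵢ`.  This module types and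
proves it.

* `IsND E x` (`E x ∈ ℂx`, the register-free form of `IsNonDemolition`), `tmul e f g` (the product ket
  `f ⊗ g` on a register split `e : X ≃ X₁ × X₂`), `jointKet r φ = φ₀ ⊗ ⋯ ⊗ φ_{r-1}`,
  `jointPhiKet r b w = ⊗ᵢ |φ_{b,wᵢ}⟩` (the joint Step-9 input of `r` runs).
* `KnowableFamily S F` — the abstract content of the single-run theory: a family of state sets `F b`
  indexed by the candidate secrets `b ∈ S` such that (i) each `F b′` lies in the linear span of each
  `F b` (for the line kets: the SUB-LINE RESOLUTION below), (ii) no member is `0`, (iii) every linear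
  operator non-demolition on every member acts on all of them as one scalar.
  **`KnowableFamily.prod`**, **`KnowableFamily.joint`** — knowable families are closed under tensor
  products (same index set `S`: a COMMON secret, independent second coordinates): the slicing argument
  `E(x ⊗ y) = x ⊗ Y` (expand `y` in the span of the matched-secret family, use non-demolition term by
  term), then the single-register scalar property on each slice, then once more on the other factor.
* **`phi8bKet_eq_sum_sublineKet`** (`gcd(p₁,Q) = 1`): `|φ_{b,v′}⟩ = Σ_{a ∈ ℤ_Q} ψ_P(−(p₁a)²) ·
  sublineKet b (v′ + 2D²(p₁a)·b)` — the line ket is the superposition of its `Q` sub-line kets, each of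
  which does not depend on the class secret (`InClass.sublineKet_eq`) and is resolved by the knowable
  coset family of ANY class secret (`sum_conj_chirp_p₁_smul_phi8bKet`); hence
  **`phi8bKet_mem_span_coset`**: `|φ_{b,v′}⟩ ∈ span {|φ_{b₂,w}⟩ : w ~ v′}` for all class secrets `b, b₂`,
  and `knowableFamily_coset`: the single-run knowable family IS a `KnowableFamily` (its scalar property
  is `IsCosetND.apply_eq_smul`).
* **`IsJointND.exists_eq_smul`** — THE MULTI-RUN THEOREM.  For odd `P = p₁Q`, odd `Q`, `gcd(p₁,Q) = 1`,
  `0 ∉ U ≠ ∅`, `bk₀ = −1`, true offsets `v′₁,…,v′_r`: every linear operator on the joint register of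
  `r` runs that is non-demolition on `⊗ᵢ|φ_{b,wᵢ}⟩` for every class secret `b` and all offsets `wᵢ` in
  the knowable cosets of the `v′ᵢ` — the weakest "never destroys the joint state on an instance it
  cannot exclude" — acts on that whole joint family as ONE scalar.  Entangling the runs buys nothing.
* **`JointAdaptiveSafe.exists_eq_smul`**, `.alive_all_or_none`, **`.histWeight_indep`**,
  `Shape.joint_histWeight_blind` — the adaptive version (generic `SafeOn.exists_eq_smul`: any adaptive
  protocol of joint instruments, each stage non-demolition on the current joint state of every instance
  still consistent with the outcomes so far, has every composed branch acting as one scalar `c(h)` on the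
  joint family; the family never shrinks; the transcript law `‖c(h)‖²` is the same on every instance —
  blind to the secret's unknown coordinates and to the positions of all `r` offsets in their cosets).
* `liftFst`, `IsND.liftFst`, **`IsCosetND.isJointND_liftFst`** — non-vacuity and comparison: a single-run
  coset-non-demolition operation applied to one register of the joint state is jointly non-demolition,
  so the multi-run theorem contains the single-run one.

## What is NOT here

The bookkeeping that Steps 1–7 hand over no offset datum beyond Claim 3.14 (census T6 (α)); the
counting form of the kick-guess bound over `Q` twins (§14.1 (γ)) — the two-twin form is
`AdaptiveSafe.kick_wrong_on_a_twin`.  Protocols that accept demolition on some consistent instance are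
one-copy measurements, governed by the output-law / window / class-twirl modules
(`twirl_multiRun_indep` is the offset-oblivious multi-run statement).  Quantum query lower bounds.
-/

namespace Literature.Computability.Cryptography.Chen2024

open scoped BigOperators

/-! ### Generic layer: non-demolition on a vector, one-scalar families, safe adaptive protocols -/

section Generic

variable {V : Type*} [AddCommMonoid V] [Module ℂ V]

/-- `E` is NON-DEMOLITION ON THE VECTOR `x`: `E x ∈ ℂ·x` — the register-free form of `IsNonDemolition`
(which is the case `V = Ket k m`). [folklore] -/
def IsND (E : V →ₗ[ℂ] V) (x : V) : Prop :=
  ∃ c : ℂ, E x = c • x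

/-- `IsNonDemolition` is `IsND` on a single register. [folklore] -/
theorem isNonDemolition_iff_isND {k m : ℕ} (E : Ket k m →ₗ[ℂ] Ket k m) (ψ : Ket k m) :
    IsNonDemolition E ψ ↔ IsND E ψ :=
  Iff.rfl

/-- A non-zero scalar does not destroy a vector. [folklore] -/
theorem smul_ne_zero_of_ne_zero {c : ℂ} (hc : c ≠ 0) {x : V} (hx : x ≠ 0) : c • x ≠ 0 := by
  intro h
  apply hx
  rw [← inv_smul_smul₀ hc x, h, smul_zero]

/-- Non-demolition on `c·x`, `c ≠ 0`, is non-demolition on `x`. [folklore] -/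
theorem IsND.of_smul {E : V →ₗ[ℂ] V} {x : V} {c : ℂ} (hc : c ≠ 0) (h : IsND E (c • x)) :
    IsND E x := by
  obtain ⟨l, hl⟩ := h
  refine ⟨l, ?_⟩
  have h2 : c • E x = c • (l • x) := by rw [← map_smul, hl, smul_comm]
  calc E x = c⁻¹ • (c • E x) := (inv_smul_smul₀ hc (E x)).symm
    _ = c⁻¹ • (c • (l • x)) := by rw [h2]
    _ = l • x := inv_smul_smul₀ hc (l • x)

/-- Non-demolition on `x` is non-demolition on `c·x`. [folklore] -/
theorem IsND.smul {E : V →ₗ[ℂ] V} {x : V} (h : IsND E x) (c : ℂ) : IsND E (c • x) := by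
  obtain ⟨l, hl⟩ := h
  exact ⟨l, by rw [map_smul, hl, smul_comm]⟩

/-- THE ONE-SCALAR PROPERTY of a set of states `G`: every linear operator that is non-demolition on
each member of `G` acts on all of `G` as ONE scalar. [folklore] -/
def OneScalarOn (G : Set V) : Prop :=
  ∀ E : V →ₗ[ℂ] V, (∀ x ∈ G, IsND E x) → ∃ c : ℂ, ∀ x ∈ G, E x = c • x

variable {K : Type*}

/-- A SAFE ADAPTIVE PROTOCOL on a set `G` of possible input states (the register-free form of
`AdaptiveSafe`): at every outcome history `h` and for every branch `κ`, the stage operator `step h κ`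
is non-demolition on the current branch state `composedOp step h x` of every member `x ∈ G` that is
still consistent with the history (branch state `≠ 0`). [folklore] -/
def SafeOn (G : Set V) (step : List K → K → (V →ₗ[ℂ] V)) : Prop :=
  ∀ (h : List K) (κ : K), ∀ x ∈ G, composedOp step h x ≠ 0 → IsND (step h κ) (composedOp step h x)

/-- **Safe adaptive protocols on a one-scalar family act by scalars.**  If `G` has the one-scalar
property and no member of `G` is `0`, every composed branch of a safe adaptive protocol acts on all of
`G` as one scalar `c(h)` (induction on the history). [folklore] -/
theorem SafeOn.exists_eq_smul {G : Set V} {step : List K → K → (V →ₗ[ℂ] V)} (hS : SafeOn G step)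
    (hG : OneScalarOn G) (hne : ∀ x ∈ G, x ≠ 0) (h : List K) :
    ∃ c : ℂ, ∀ x ∈ G, composedOp step h x = c • x := by
  induction h with
  | nil => exact ⟨1, fun x _ => by rw [composedOp_nil, LinearMap.id_apply, one_smul]⟩
  | cons κ h ih =>
    obtain ⟨c, hc⟩ := ih
    by_cases hc0 : c = 0
    · exact ⟨0, fun x hx => by rw [composedOp_cons_apply, hc x hx, hc0, zero_smul, map_zero]⟩
    · have hE : ∀ x ∈ G, IsND (step h κ) x := by
        intro x hx
        have hne' : composedOp step h x ≠ 0 := by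
          rw [hc x hx]
          exact smul_ne_zero_of_ne_zero hc0 (hne x hx)
        have h1 := hS h κ x hx hne'
        rw [hc x hx] at h1
        exact h1.of_smul hc0
      obtain ⟨d, hd⟩ := hG (step h κ) hE
      exact ⟨c * d, fun x hx => by
        rw [composedOp_cons_apply, hc x hx, map_smul, hd x hx, smul_smul]⟩

/-- If every stage operator is non-demolition on every member of a one-scalar family, every composed
branch acts on the family as one scalar. [folklore] -/
theorem exists_eq_smul_of_forall_isND {G : Set V} {step : List K → K → (V →ₗ[ℂ] V)}
    (hG : OneScalarOn G) (h : ∀ hist κ, ∀ x ∈ G, IsND (step hist κ) x) (hist : List K) :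
    ∃ c : ℂ, ∀ x ∈ G, composedOp step hist x = c • x := by
  induction hist with
  | nil => exact ⟨1, fun x _ => by rw [composedOp_nil, LinearMap.id_apply, one_smul]⟩
  | cons κ hist ih =>
    obtain ⟨c, hc⟩ := ih
    obtain ⟨d, hd⟩ := hG (step hist κ) (h hist κ)
    exact ⟨c * d, fun x hx => by
      rw [composedOp_cons_apply, hc x hx, map_smul, hd x hx, smul_smul]⟩

/-- Non-vacuity: a protocol all of whose stage operators are non-demolition on every member of a
one-scalar family is safe on it. [folklore] -/
theorem SafeOn.of_forall_isND {G : Set V} {step : List K → K → (V →ₗ[ℂ] V)} (hG : OneScalarOn G)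
    (h : ∀ hist κ, ∀ x ∈ G, IsND (step hist κ) x) : SafeOn G step := by
  intro hist κ x hx _
  obtain ⟨c, hc⟩ := exists_eq_smul_of_forall_isND hG h hist
  rw [hc x hx]
  exact (h hist κ x hx).smul c

/-- **The family never shrinks**: after any history of a safe adaptive protocol on a one-scalar family,
either every member is still consistent with the history or none is. [folklore] -/
theorem SafeOn.alive_all_or_none {G : Set V} {step : List K → K → (V →ₗ[ℂ] V)} (hS : SafeOn G step)
    (hG : OneScalarOn G) (hne : ∀ x ∈ G, x ≠ 0) (h : List K) :
    (∀ x ∈ G, composedOp step h x ≠ 0) ∨ (∀ x ∈ G, composedOp step h x = 0) := by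
  obtain ⟨c, hc⟩ := hS.exists_eq_smul hG hne h
  by_cases hc0 : c = 0
  · exact Or.inr fun x hx => by rw [hc x hx, hc0, zero_smul]
  · exact Or.inl fun x hx => by
      rw [hc x hx]
      exact smul_ne_zero_of_ne_zero hc0 (hne x hx)

end Generic

/-! ### Born weights on a general finite register -/

section Born

variable {X : Type*} [Fintype X] {K : Type*}

/-- Total Born weight `Σ_x |Ψ(x)|²` of a state on a finite register. [folklore] -/
noncomputable def bornTotal (Ψ : X → ℂ) : ℝ :=
  ∑ x, ‖Ψ x‖ ^ 2

/-- `Σ_x |cΨ(x)|² = |c|² Σ_x |Ψ(x)|²`. [folklore] -/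
theorem bornTotal_smul (c : ℂ) (Ψ : X → ℂ) : bornTotal (c • Ψ) = ‖c‖ ^ 2 * bornTotal Ψ := by
  unfold bornTotal
  rw [Finset.mul_sum]
  refine Finset.sum_congr rfl fun x _ => ?_
  rw [Pi.smul_apply, smul_eq_mul, norm_mul, mul_pow]

/-- A non-zero state has positive total Born weight. [folklore] -/
theorem bornTotal_pos {Ψ : X → ℂ} (hΨ : Ψ ≠ 0) : 0 < bornTotal Ψ := by
  obtain ⟨x, hx⟩ : ∃ x, Ψ x ≠ 0 := Function.ne_iff.1 hΨ
  unfold bornTotal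
  calc (0 : ℝ) < ‖Ψ x‖ ^ 2 := by positivity
    _ ≤ ∑ y, ‖Ψ y‖ ^ 2 :=
        Finset.single_le_sum (f := fun y => ‖Ψ y‖ ^ 2) (fun y _ => sq_nonneg _) (Finset.mem_univ x)

/-- THE BORN WEIGHT OF A HISTORY of an adaptive protocol on the input `Ψ` (register-free form of
`histProb`): total weight of the branch state over total weight of `Ψ`. [folklore] -/
noncomputable def histWeight {V : Type*} (step : List K → K → ((V → ℂ) →ₗ[ℂ] (V → ℂ))) [Fintype V]
    (h : List K) (Ψ : V → ℂ) : ℝ :=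
  bornTotal (composedOp step h Ψ) / bornTotal Ψ

/-- On a single register `histWeight` is `histProb`. [folklore] -/
theorem histProb_eq_histWeight {k m : ℕ} [NeZero m] (step : List K → K → (Ket k m →ₗ[ℂ] Ket k m))
    (h : List K) (ψ : Ket k m) : histProb step h ψ = histWeight step h ψ :=
  rfl

/-- If the branch state is `c·Ψ`, `Ψ ≠ 0`, the history has Born weight `‖c‖²`. [folklore] -/
theorem histWeight_eq_of_eq_smul {V : Type*} [Fintype V]
    {step : List K → K → ((V → ℂ) →ₗ[ℂ] (V → ℂ))} {h : List K} {Ψ : V → ℂ} {c : ℂ}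
    (hc : composedOp step h Ψ = c • Ψ) (hΨ : Ψ ≠ 0) : histWeight step h Ψ = ‖c‖ ^ 2 := by
  rw [histWeight, hc, bornTotal_smul, mul_div_assoc, div_self (bornTotal_pos hΨ).ne', mul_one]

end Born

/-! ### Product kets and the tensor product of knowable families -/

section Product

variable {X X₁ X₂ : Type*} (e : X ≃ X₁ × X₂)

/-- THE PRODUCT KET `f ⊗ g` on a register `X` split as `X ≃ X₁ × X₂`: `(f ⊗ g)(x) = f(x₁)·g(x₂)`.
[folklore] -/
def tmul (f : X₁ → ℂ) (g : X₂ → ℂ) : X → ℂ :=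
  fun x => f (e x).1 * g (e x).2

/-- Pointwise value of a product ket. [folklore] -/
theorem tmul_apply (f : X₁ → ℂ) (g : X₂ → ℂ) (x : X) : tmul e f g x = f (e x).1 * g (e x).2 := rfl

/-- `(f ⊗ g)(x₁,x₂) = f(x₁)g(x₂)`. [folklore] -/
@[simp] theorem tmul_apply_symm (f : X₁ → ℂ) (g : X₂ → ℂ) (x₁ : X₁) (x₂ : X₂) :
    tmul e f g (e.symm (x₁, x₂)) = f x₁ * g x₂ := by
  simp [tmul]

/-- `⊗` is additive on the left. [folklore] -/
theorem tmul_add_left (f f' : X₁ → ℂ) (g : X₂ → ℂ) :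
    tmul e (f + f') g = tmul e f g + tmul e f' g := by
  funext x; simp [tmul, add_mul]

/-- `⊗` is additive on the right. [folklore] -/
theorem tmul_add_right (f : X₁ → ℂ) (g g' : X₂ → ℂ) :
    tmul e f (g + g') = tmul e f g + tmul e f g' := by
  funext x; simp [tmul, mul_add]

/-- `⊗` is homogeneous on the left. [folklore] -/
theorem tmul_smul_left (c : ℂ) (f : X₁ → ℂ) (g : X₂ → ℂ) :
    tmul e (c • f) g = c • tmul e f g := by
  funext x; simp [tmul, mul_assoc]

/-- `⊗` is homogeneous on the right. [folklore] -/
theorem tmul_smul_right (c : ℂ) (f : X₁ → ℂ) (g : X₂ → ℂ) :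
    tmul e f (c • g) = c • tmul e f g := by
  funext x; simp only [tmul, Pi.smul_apply, smul_eq_mul]; ring

/-- `0 ⊗ g = 0`. [folklore] -/
theorem tmul_zero_left (g : X₂ → ℂ) : tmul e 0 g = 0 := by
  funext x; simp [tmul]

/-- `f ⊗ 0 = 0`. [folklore] -/
theorem tmul_zero_right (f : X₁ → ℂ) : tmul e f 0 = 0 := by
  funext x; simp [tmul]

/-- `⊗` as a bilinear map. [folklore] -/
def tmulBil : (X₁ → ℂ) →ₗ[ℂ] (X₂ → ℂ) →ₗ[ℂ] (X → ℂ) :=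
  LinearMap.mk₂ ℂ (tmul e) (tmul_add_left e) (tmul_smul_left e) (tmul_add_right e)
    (tmul_smul_right e)

/-- The bilinear map is `⊗`. [folklore] -/
@[simp] theorem tmulBil_apply (f : X₁ → ℂ) (g : X₂ → ℂ) : tmulBil e f g = tmul e f g := rfl

/-- `span s ⊗ span t ⊆ span (s ⊗ t)`. [folklore] -/
theorem tmul_mem_span {s : Set (X₁ → ℂ)} {t : Set (X₂ → ℂ)} {f : X₁ → ℂ} {g : X₂ → ℂ}
    (hf : f ∈ Submodule.span ℂ s) (hg : g ∈ Submodule.span ℂ t) :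
    tmul e f g ∈ Submodule.span ℂ (Set.image2 (tmul e) s t) := by
  have h := Submodule.apply_mem_map₂ (tmulBil e) hf hg
  rw [Submodule.map₂_span_span] at h
  exact h

/-- A product of non-zero kets is non-zero. [folklore] -/
theorem tmul_ne_zero {f : X₁ → ℂ} {g : X₂ → ℂ} (hf : f ≠ 0) (hg : g ≠ 0) : tmul e f g ≠ 0 := by
  obtain ⟨x₁, hx₁⟩ : ∃ x₁, f x₁ ≠ 0 := Function.ne_iff.1 hf
  obtain ⟨x₂, hx₂⟩ : ∃ x₂, g x₂ ≠ 0 := Function.ne_iff.1 hg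
  intro h
  have h1 := congr_fun h (e.symm (x₁, x₂))
  rw [tmul_apply_symm, Pi.zero_apply] at h1
  exact mul_ne_zero hx₁ hx₂ h1

/-- `f ⊗ g = f ⊗ g′`, `f ≠ 0` ⇒ `g = g′`. [folklore] -/
theorem tmul_right_cancel {f : X₁ → ℂ} (hf : f ≠ 0) {g g' : X₂ → ℂ}
    (h : tmul e f g = tmul e f g') : g = g' := by
  obtain ⟨x₁, hx₁⟩ : ∃ x₁, f x₁ ≠ 0 := Function.ne_iff.1 hf
  funext x₂
  have h1 := congr_fun h (e.symm (x₁, x₂))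
  rw [tmul_apply_symm, tmul_apply_symm] at h1
  exact mul_left_cancel₀ hx₁ h1

/-- `a·x = a′·x`, `x ≠ 0` ⇒ `a = a′` (kets). [folklore] -/
theorem smul_cancel_of_ne_zero {Y : Type*} {x : Y → ℂ} (hx : x ≠ 0) {a a' : ℂ}
    (h : a • x = a' • x) : a = a' := by
  obtain ⟨i, hi⟩ : ∃ i, x i ≠ 0 := Function.ne_iff.1 hx
  have h1 := congr_fun h i
  simp only [Pi.smul_apply, smul_eq_mul] at h1
  exact mul_right_cancel₀ hi h1

/-- The joint operator `E` restricted to the slice `x₂` after tensoring with `y`: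
`f ↦ (x₁ ↦ E(f ⊗ y)(x₁,x₂))`, an operator on the first register. [folklore] -/
def sliceOp₁ (E : (X → ℂ) →ₗ[ℂ] (X → ℂ)) (y : X₂ → ℂ) (x₂ : X₂) : (X₁ → ℂ) →ₗ[ℂ] (X₁ → ℂ) :=
  (LinearMap.funLeft ℂ ℂ fun x₁ : X₁ => e.symm (x₁, x₂)) ∘ₗ E ∘ₗ (tmulBil e).flip y

/-- Value of the first slice operator. [folklore] -/
theorem sliceOp₁_apply (E : (X → ℂ) →ₗ[ℂ] (X → ℂ)) (y : X₂ → ℂ) (x₂ : X₂) (f : X₁ → ℂ) (x₁ : X₁) :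
    sliceOp₁ e E y x₂ f x₁ = E (tmul e f y) (e.symm (x₁, x₂)) := rfl

/-- The joint operator `E` restricted to the slice `x₁` after tensoring with `f`:
`g ↦ (x₂ ↦ E(f ⊗ g)(x₁,x₂))`, an operator on the second register. [folklore] -/
def sliceOp₂ (E : (X → ℂ) →ₗ[ℂ] (X → ℂ)) (f : X₁ → ℂ) (x₁ : X₁) : (X₂ → ℂ) →ₗ[ℂ] (X₂ → ℂ) :=
  (LinearMap.funLeft ℂ ℂ fun x₂ : X₂ => e.symm (x₁, x₂)) ∘ₗ E ∘ₗ tmulBil e f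

/-- Value of the second slice operator. [folklore] -/
theorem sliceOp₂_apply (E : (X → ℂ) →ₗ[ℂ] (X → ℂ)) (f : X₁ → ℂ) (x₁ : X₁) (g : X₂ → ℂ) (x₂ : X₂) :
    sliceOp₂ e E f x₁ g x₂ = E (tmul e f g) (e.symm (x₁, x₂)) := rfl

variable {B : Type*}

/-- **A KNOWABLE FAMILY** of states on a register `V`, indexed by a set `S` of candidate secrets: for
each `b ∈ S` a set `F b` of states (for Step 9: the line kets `|φ_{b,w}⟩`, `w` in the knowable coset)
such that (i) `F b′ ⊆ span (F b)` for all `b, b′ ∈ S`, (ii) `0 ∉ F b`, (iii) ONE-SCALAR PROPERTY: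
every linear operator non-demolition on every member acts on all members as one scalar.  The abstract
content of `ChenQuantumLWECosetNonDemolition` (`knowableFamily_coset` below), isolated so that it can
be tensored. [cite: ChenQuantumLattice2024, §3.5.9 pp. 34–38, Claim 3.14 pp. 33–34, eq. (12) p. 17] -/
structure KnowableFamily {V : Type*} [AddCommMonoid V] [Module ℂ V] (S : Set B) (F : B → Set V) :
    Prop where
  sub_span : ∀ ⦃b⦄, b ∈ S → ∀ ⦃b'⦄, b' ∈ S → ∀ ⦃x⦄, x ∈ F b' → x ∈ Submodule.span ℂ (F b)
  ne_zero : ∀ ⦃b⦄, b ∈ S → ∀ ⦃x⦄, x ∈ F b → x ≠ 0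
  scalar : ∀ E : V →ₗ[ℂ] V, (∀ b ∈ S, ∀ x ∈ F b, IsND E x) →
    ∃ c : ℂ, ∀ b ∈ S, ∀ x ∈ F b, E x = c • x

/-- The set of all states of a family. [folklore] -/
def famUnion {V : Type*} (S : Set B) (F : B → Set V) : Set V :=
  {x | ∃ b ∈ S, x ∈ F b}

/-- A knowable family has the one-scalar property as a set. [folklore] -/
theorem KnowableFamily.oneScalarOn {V : Type*} [AddCommMonoid V] [Module ℂ V] {S : Set B}
    {F : B → Set V} (hF : KnowableFamily S F) : OneScalarOn (famUnion S F) := by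
  intro E hE
  obtain ⟨c, hc⟩ := hF.scalar E fun b hb x hx => hE x ⟨b, hb, hx⟩
  exact ⟨c, fun x ⟨b, hb, hx⟩ => hc b hb x hx⟩

/-- No state of a knowable family is `0`. [folklore] -/
theorem KnowableFamily.ne_zero_union {V : Type*} [AddCommMonoid V] [Module ℂ V] {S : Set B}
    {F : B → Set V} (hF : KnowableFamily S F) : ∀ x ∈ famUnion S F, x ≠ 0 :=
  fun _ ⟨_, hb, hx⟩ => hF.ne_zero hb hx

/-- THE TENSOR PRODUCT OF TWO FAMILIES with a COMMON secret: `(F₁ ⊗ F₂) b = {x ⊗ y : x ∈ F₁ b, y ∈ F₂ b}`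
(independent second coordinates, same `b`). [folklore] -/
def prodFamily (F₁ : B → Set (X₁ → ℂ)) (F₂ : B → Set (X₂ → ℂ)) (b : B) : Set (X → ℂ) :=
  Set.image2 (tmul e) (F₁ b) (F₂ b)

/-- **Knowable families are closed under tensor products.**  The heart of the multi-run theorem: if
every operator non-demolition on each `x ∈ F₁ b` (all `b ∈ S`) is one scalar, and likewise for `F₂`,
then every operator on the PRODUCT register non-demolition on each `x ⊗ y` (`x ∈ F₁ b`, `y ∈ F₂ b`,
same `b`) is one scalar — entangling operations included.  Proof: `E(x ⊗ y) = x ⊗ Y` by expanding `y`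
in `span (F₂ b₁)` (`b₁` the secret of `x`) and using non-demolition term by term; the slices
`x ↦ E(x ⊗ y)(·,x₂)` are then non-demolition on the first family, hence scalars, so `Y` does not depend
on `x`; matching secrets once gives `Y = c_y·y`; the slices `y ↦ E(x₀ ⊗ y)(x₁,·)` make `c_y` constant.
[cite: ChenQuantumLattice2024, §3.5.9 pp. 34–38] -/
theorem KnowableFamily.prod {S : Set B} {F₁ : B → Set (X₁ → ℂ)} {F₂ : B → Set (X₂ → ℂ)}
    (h₁ : KnowableFamily S F₁) (h₂ : KnowableFamily S F₂) (e : X ≃ X₁ × X₂) :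
    KnowableFamily S (prodFamily e F₁ F₂) where
  sub_span := by
    rintro b hb b' hb' z ⟨x, hx, y, hy, rfl⟩
    exact tmul_mem_span e (h₁.sub_span hb hb' hx) (h₂.sub_span hb hb' hy)
  ne_zero := by
    rintro b hb z ⟨x, hx, y, hy, rfl⟩
    exact tmul_ne_zero e (h₁.ne_zero hb hx) (h₂.ne_zero hb hy)
  scalar := by
    intro E hE
    -- Step 1: for a fixed second factor `y ∈ F₂ b₂`, one scalar on all `x ⊗ y`.
    have step1 : ∀ b₂ ∈ S, ∀ y ∈ F₂ b₂, ∃ c : ℂ, ∀ b₁ ∈ S, ∀ x ∈ F₁ b₁,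
        E (tmul e x y) = c • tmul e x y := by
      intro b₂ hb₂ y hy
      -- (a) `E (x ⊗ y) = x ⊗ Y` for some `Y`
      have hA : ∀ b₁ ∈ S, ∀ x ∈ F₁ b₁, ∃ Y : X₂ → ℂ, E (tmul e x y) = tmul e x Y := by
        intro b₁ hb₁ x hx
        have hy' : y ∈ Submodule.span ℂ (F₂ b₁) := h₂.sub_span hb₁ hb₂ hy
        refine Submodule.span_induction
          (p := fun z _ => ∃ Y : X₂ → ℂ, E (tmul e x z) = tmul e x Y) ?_ ?_ ?_ ?_ hy'
        · intro z hz
          obtain ⟨c, hc⟩ := hE b₁ hb₁ _ ⟨x, hx, z, hz, rfl⟩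
          exact ⟨c • z, by rw [tmul_smul_right, hc]⟩
        · exact ⟨0, by rw [tmul_zero_right, map_zero]⟩
        · intro z z' _ _ hz hz'
          obtain ⟨Y, hY⟩ := hz
          obtain ⟨Y', hY'⟩ := hz'
          exact ⟨Y + Y', by rw [tmul_add_right, map_add, hY, hY', tmul_add_right]⟩
        · intro a z _ hz
          obtain ⟨Y, hY⟩ := hz
          exact ⟨a • Y, by rw [tmul_smul_right, map_smul, hY, tmul_smul_right]⟩
      -- (b) the slices are non-demolition on the first family, hence one scalar `μ x₂` each
      have hB : ∀ x₂ : X₂, ∃ μ : ℂ, ∀ b₁ ∈ S, ∀ x ∈ F₁ b₁, sliceOp₁ e E y x₂ x = μ • x := by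
        intro x₂
        refine h₁.scalar (sliceOp₁ e E y x₂) fun b₁ hb₁ x hx => ?_
        obtain ⟨Y, hY⟩ := hA b₁ hb₁ x hx
        refine ⟨Y x₂, ?_⟩
        funext x₁
        rw [sliceOp₁_apply, hY, tmul_apply_symm, Pi.smul_apply, smul_eq_mul, mul_comm]
      choose μ hμ using hB
      -- (c) hence `E (x ⊗ y) = x ⊗ μ` with `μ` independent of `x`
      have hC : ∀ b₁ ∈ S, ∀ x ∈ F₁ b₁, E (tmul e x y) = tmul e x μ := by
        intro b₁ hb₁ x hx
        obtain ⟨Y, hY⟩ := hA b₁ hb₁ x hx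
        have hYμ : Y = μ := by
          funext x₂
          have h1 : sliceOp₁ e E y x₂ x = Y x₂ • x := by
            funext x₁
            rw [sliceOp₁_apply, hY, tmul_apply_symm, Pi.smul_apply, smul_eq_mul, mul_comm]
          exact smul_cancel_of_ne_zero (h₁.ne_zero hb₁ hx) (h1.symm.trans (hμ x₂ b₁ hb₁ x hx))
        rw [hY, hYμ]
      -- (d) matching secrets once: `μ = c·y`
      by_cases hne : (F₁ b₂).Nonempty
      · obtain ⟨x₀, hx₀⟩ := hne
        obtain ⟨c, hc⟩ := hE b₂ hb₂ _ ⟨x₀, hx₀, y, hy, rfl⟩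
        have hμy : μ = c • y := by
          refine tmul_right_cancel e (h₁.ne_zero hb₂ hx₀) ?_
          rw [← hC b₂ hb₂ x₀ hx₀, hc, tmul_smul_right]
        refine ⟨c, fun b₁ hb₁ x hx => ?_⟩
        rw [hC b₁ hb₁ x hx, hμy, tmul_smul_right]
      · refine ⟨0, fun b₁ hb₁ x hx => ?_⟩
        exfalso
        have h0 := h₁.sub_span hb₂ hb₁ hx
        rw [Set.not_nonempty_iff_eq_empty.1 hne, Submodule.span_empty, Submodule.mem_bot] at h0
        exact h₁.ne_zero hb₁ hx h0
    -- Step 2: the scalar does not depend on the second factor either.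
    choose! c hc using step1
    by_cases hS : ∃ b₀ ∈ S, (F₁ b₀).Nonempty
    · obtain ⟨b₀, hb₀, x₀, hx₀⟩ := hS
      obtain ⟨x₁, hx₁⟩ : ∃ x₁, x₀ x₁ ≠ 0 := Function.ne_iff.1 (h₁.ne_zero hb₀ hx₀)
      have hR : ∀ b₂ ∈ S, ∀ y ∈ F₂ b₂, sliceOp₂ e E x₀ x₁ y = (c b₂ y * x₀ x₁) • y := by
        intro b₂ hb₂ y hy
        funext x₂
        rw [sliceOp₂_apply, hc b₂ hb₂ y hy b₀ hb₀ x₀ hx₀]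
        simp only [Pi.smul_apply, smul_eq_mul, tmul_apply_symm]
        ring
      obtain ⟨ν, hν⟩ := h₂.scalar (sliceOp₂ e E x₀ x₁) fun b₂ hb₂ y hy =>
        ⟨c b₂ y * x₀ x₁, hR b₂ hb₂ y hy⟩
      refine ⟨ν / x₀ x₁, ?_⟩
      rintro b hb z ⟨x, hx, y, hy, rfl⟩
      have hcy : c b y * x₀ x₁ = ν :=
        smul_cancel_of_ne_zero (h₂.ne_zero hb hy) ((hR b hb y hy).symm.trans (hν b hb y hy))
      rw [hc b hb y hy b hb x hx, ← hcy, mul_div_cancel_right₀ _ hx₁]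
    · refine ⟨0, ?_⟩
      rintro b hb z ⟨x, hx, y, hy, rfl⟩
      exact (hS ⟨b, hb, x, hx⟩).elim

/-- A SINGLE-REGISTER OPERATION APPLIED TO THE FIRST FACTOR of the split register (`E₁ ⊗ 1`).
[folklore] -/
noncomputable def liftFst (E₁ : (X₁ → ℂ) →ₗ[ℂ] (X₁ → ℂ)) : (X → ℂ) →ₗ[ℂ] (X → ℂ) where
  toFun Ψ := fun x => E₁ (fun x₁ => Ψ (e.symm (x₁, (e x).2))) (e x).1
  map_add' Ψ Ψ' := by
    funext x
    have : (fun x₁ => (Ψ + Ψ') (e.symm (x₁, (e x).2)))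
        = (fun x₁ => Ψ (e.symm (x₁, (e x).2))) + fun x₁ => Ψ' (e.symm (x₁, (e x).2)) := rfl
    rw [this, map_add]
    rfl
  map_smul' a Ψ := by
    funext x
    have : (fun x₁ => (a • Ψ) (e.symm (x₁, (e x).2)))
        = a • fun x₁ => Ψ (e.symm (x₁, (e x).2)) := rfl
    rw [this, map_smul]
    rfl

/-- `(E₁ ⊗ 1)(f ⊗ g) = (E₁ f) ⊗ g`. [folklore] -/
theorem liftFst_tmul (E₁ : (X₁ → ℂ) →ₗ[ℂ] (X₁ → ℂ)) (f : X₁ → ℂ) (g : X₂ → ℂ) :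
    liftFst e E₁ (tmul e f g) = tmul e (E₁ f) g := by
  funext x
  show E₁ (fun x₁ => tmul e f g (e.symm (x₁, (e x).2))) (e x).1 = _
  have : (fun x₁ => tmul e f g (e.symm (x₁, (e x).2))) = g (e x).2 • f := by
    funext x₁; rw [tmul_apply_symm, Pi.smul_apply, smul_eq_mul, mul_comm]
  rw [this, map_smul, Pi.smul_apply, smul_eq_mul, tmul_apply, mul_comm]

/-- A first-factor operation non-demolition on `f` is non-demolition on every `f ⊗ g`. [folklore] -/
theorem IsND.liftFst {E₁ : (X₁ → ℂ) →ₗ[ℂ] (X₁ → ℂ)} {f : X₁ → ℂ} (h : IsND E₁ f)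
    (g : X₂ → ℂ) : IsND (liftFst e E₁) (tmul e f g) := by
  obtain ⟨c, hc⟩ := h
  exact ⟨c, by rw [liftFst_tmul, hc, tmul_smul_left]⟩

end Product

/-! ### Joint kets of `r` registers -/

section Joint

variable {Y : Type*} {B : Type*}

/-- THE JOINT (TENSOR) KET of `r` registers: `(φ₀ ⊗ ⋯ ⊗ φ_{r-1})(x) = ∏ᵢ φᵢ(xᵢ)`. [folklore] -/
def jointKet (r : ℕ) (φ : Fin r → (Y → ℂ)) : (Fin r → Y) → ℂ :=
  fun x => ∏ i, φ i (x i)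

/-- Pointwise value of a joint ket. [folklore] -/
theorem jointKet_apply (r : ℕ) (φ : Fin r → (Y → ℂ)) (x : Fin r → Y) :
    jointKet r φ x = ∏ i, φ i (x i) := rfl

/-- Splitting the joint register of `r+1` runs into the first run and the rest. [folklore] -/
def splitEquiv (r : ℕ) (Y : Type*) : (Fin (r + 1) → Y) ≃ Y × (Fin r → Y) :=
  (Fin.consEquiv fun _ => Y).symm

/-- The split, forwards. [folklore] -/
@[simp] theorem splitEquiv_apply (r : ℕ) (x : Fin (r + 1) → Y) :
    splitEquiv r Y x = (x 0, Fin.tail x) := rfl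

/-- The split, backwards. [folklore] -/
@[simp] theorem splitEquiv_symm_apply (r : ℕ) (y : Y) (x : Fin r → Y) :
    (splitEquiv r Y).symm (y, x) = Fin.cons y x := rfl

/-- The joint ket of no register is the scalar `1`. [folklore] -/
theorem jointKet_zero (φ : Fin 0 → (Y → ℂ)) : jointKet 0 φ = fun _ => 1 := by
  funext x; simp [jointKet]

/-- `φ₀ ⊗ ⋯ ⊗ φ_r = φ₀ ⊗ (φ₁ ⊗ ⋯ ⊗ φ_r)`. [folklore] -/
theorem jointKet_succ {r : ℕ} (φ : Fin (r + 1) → (Y → ℂ)) :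
    jointKet (r + 1) φ = tmul (splitEquiv r Y) (φ 0) (jointKet r (Fin.tail φ)) := by
  funext x
  simp only [jointKet_apply, tmul_apply, splitEquiv_apply, Fin.prod_univ_succ, Fin.tail]

/-- THE JOINT FAMILY of `r` families with a COMMON secret: `{⊗ᵢ φᵢ : φᵢ ∈ Fᵢ b}`. [folklore] -/
def jointFamily (r : ℕ) (F : Fin r → B → Set (Y → ℂ)) (b : B) : Set ((Fin r → Y) → ℂ) :=
  {Ψ | ∃ φ : Fin r → (Y → ℂ), (∀ i, φ i ∈ F i b) ∧ Ψ = jointKet r φ}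

/-- The joint family of no register is `{1}`. [folklore] -/
theorem jointFamily_zero (F : Fin 0 → B → Set (Y → ℂ)) (b : B) :
    jointFamily 0 F b = {fun _ => 1} := by
  ext Ψ
  simp only [jointFamily, Set.mem_setOf_eq, Set.mem_singleton_iff, jointKet_zero]
  constructor
  · rintro ⟨φ, -, rfl⟩; rfl
  · rintro rfl; exact ⟨fun i => Fin.elim0 i, fun i => Fin.elim0 i, rfl⟩

/-- The joint family of `r+1` registers is the product of the first with the joint family of the rest.
[folklore] -/
theorem jointFamily_succ {r : ℕ} (F : Fin (r + 1) → B → Set (Y → ℂ)) :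
    jointFamily (r + 1) F = prodFamily (splitEquiv r Y) (F 0) (jointFamily r (Fin.tail F)) := by
  funext b
  ext Ψ
  constructor
  · rintro ⟨φ, hφ, rfl⟩
    exact ⟨φ 0, hφ 0, jointKet r (Fin.tail φ), ⟨Fin.tail φ, fun i => hφ i.succ, rfl⟩,
      (jointKet_succ φ).symm⟩
  · rintro ⟨f, hf, Ψ', ⟨φ', hφ', rfl⟩, rfl⟩
    refine ⟨Fin.cons f φ', fun i => ?_, ?_⟩
    · refine Fin.cases ?_ (fun j => ?_) i
      · rw [Fin.cons_zero]; exact hf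
      · rw [Fin.cons_succ]; exact hφ' j
    · rw [jointKet_succ, Fin.cons_zero, Fin.tail_cons]

/-- **Joint families of knowable families are knowable** (induction on `r` with
`KnowableFamily.prod`). [cite: ChenQuantumLattice2024, §3.5.9 pp. 34–38] -/
theorem KnowableFamily.joint {S : Set B} :
    ∀ (r : ℕ) {F : Fin r → B → Set (Y → ℂ)},
      (∀ i, KnowableFamily S (F i)) → KnowableFamily S (jointFamily r F)
  | 0, F, _ => by
      refine ⟨?_, ?_, ?_⟩
      · intro b _ b' _ Ψ hΨ
        rw [jointFamily_zero] at hΨ ⊢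
        exact Submodule.subset_span hΨ
      · intro b _ Ψ hΨ h0
        rw [jointFamily_zero, Set.mem_singleton_iff] at hΨ
        have h1 := congr_fun h0 fun i => Fin.elim0 i
        rw [hΨ, Pi.zero_apply] at h1
        exact one_ne_zero h1
      · intro E hE
        by_cases hS : S.Nonempty
        · obtain ⟨b₀, hb₀⟩ := hS
          obtain ⟨c, hc⟩ := hE b₀ hb₀ (fun _ => 1)
            (by rw [jointFamily_zero]; exact Set.mem_singleton _)
          refine ⟨c, fun b _ Ψ hΨ => ?_⟩
          rw [jointFamily_zero, Set.mem_singleton_iff] at hΨ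
          rw [hΨ]
          exact hc
        · exact ⟨0, fun b hb _ _ => (hS ⟨b, hb⟩).elim⟩
  | r + 1, F, hF => by
      rw [jointFamily_succ]
      exact (hF 0).prod (KnowableFamily.joint r fun i => hF i.succ) (splitEquiv r Y)

end Joint

/-! ### The single-run knowable family is a knowable family: the sub-line resolution -/

section SingleRun

variable (n : ℕ) (D p₁ Q : ℕ+)

/-- Shifting the offset along the line re-indexes the sub-line ket:
`sublineKet b (v′ + 2D²s·b) = Σ_{j ≡ s (Q)} ψ_P(−(j−s)²)|2D²j·b + v′⟩`. [cite: ChenQuantumLattice2024, §3.5.9 p. 35] -/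
theorem sublineKet_lineShift (b v' : Fin (n + 1) → ℤ) (s : ℤ) :
    sublineKet n D p₁ Q b (lineShift n D b v' s)
      = lineKet (ptB n D p₁ Q b v')
          (fun j => if toQ p₁ Q (j - ((s : ℤ) : ZP p₁ Q)) = 0
            then (ZMod.stdAddChar (-((j - ((s : ℤ) : ZP p₁ Q)) ^ 2) : ZP p₁ Q) : ℂ) else 0) := by
  funext z
  unfold sublineKet lineKet
  simp_rw [ptB_lineShift]
  exact Fintype.sum_equiv (Equiv.addRight ((s : ℤ) : ZP p₁ Q)) _ _ (fun j => by
    simp only [Equiv.coe_addRight, add_sub_cancel_right])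

/-- Re-centring the chirp at a point `s = p₁t` of the sub-line through it costs a constant:
`ψ_P(−(j−s)²) = ψ_P(−j²)·ψ_P(s²)` for `j ≡ s (mod Q)` (`(j−s)s = 0` in `ℤ_P`). [folklore] -/
theorem chirp_recentre (t j : ZP p₁ Q) (hj : toQ p₁ Q (j - ((p₁ : ℕ) : ZP p₁ Q) * t) = 0) :
    (ZMod.stdAddChar (-((j - ((p₁ : ℕ) : ZP p₁ Q) * t) ^ 2) : ZP p₁ Q) : ℂ)
      = (ZMod.stdAddChar (-(j ^ 2) : ZP p₁ Q) : ℂ)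
          * (ZMod.stdAddChar ((((p₁ : ℕ) : ZP p₁ Q) * t) ^ 2 : ZP p₁ Q) : ℂ) := by
  obtain ⟨y, hy⟩ := exists_eq_Q_mul_of_toQ_eq_zero p₁ Q hj
  have h0 : (j - ((p₁ : ℕ) : ZP p₁ Q) * t) * (((p₁ : ℕ) : ZP p₁ Q) * t) = 0 := by
    rw [hy]
    calc ((Q : ℕ) : ZP p₁ Q) * y * (((p₁ : ℕ) : ZP p₁ Q) * t)
        = ((p₁ : ℕ) : ZP p₁ Q) * ((Q : ℕ) : ZP p₁ Q) * (y * t) := by ring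
      _ = 0 := by rw [p₁_mul_Q_eq_zero, zero_mul]
  rw [← AddChar.map_add_eq_mul]
  congr 1
  linear_combination (2 : ZP p₁ Q) * h0

/-- **SUB-LINE RESOLUTION OF THE LINE KET** (`gcd(p₁,Q) = 1`):
`|φ_{b,v′}⟩ = Σ_{a ∈ ℤ_Q} ψ_P(−(p₁a)²) · sublineKet b (v′ + 2D²(p₁a)·b)` — the line is the disjoint
union of its `Q` sub-lines `j ≡ p₁a (mod Q)`, and on each the chirp is the re-centred chirp times a
constant. [cite: ChenQuantumLattice2024, §3.5.9 p. 35; folklore] -/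
theorem phi8bKet_eq_sum_sublineKet (hpQ : Nat.Coprime (p₁ : ℕ) (Q : ℕ)) (b v' : Fin (n + 1) → ℤ) :
    phi8bKet n D p₁ Q b v'
      = ∑ a : ZQ Q, (ZMod.stdAddChar (-((((p₁ : ℕ) : ZP p₁ Q) * ((a.val : ℕ) : ZP p₁ Q)) ^ 2) :
            ZP p₁ Q) : ℂ)
          • sublineKet n D p₁ Q b (lineShift n D b v' (((p₁ : ℕ) : ℤ) * ((a.val : ℕ) : ℤ))) := by
  have hcast : ∀ a : ZQ Q, ((((p₁ : ℕ) : ℤ) * ((a.val : ℕ) : ℤ) : ℤ) : ZP p₁ Q)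
      = ((p₁ : ℕ) : ZP p₁ Q) * ((a.val : ℕ) : ZP p₁ Q) := by
    intro a; push_cast; ring
  simp_rw [sublineKet_lineShift, hcast]
  rw [sum_smul_lineKet]
  unfold phi8bKet
  congr 1
  funext j
  obtain ⟨u, hu⟩ := (ZMod.isUnit_iff_coprime _ _).2 hpQ
  have hcond : ∀ a : ZQ Q,
      toQ p₁ Q (j - ((p₁ : ℕ) : ZP p₁ Q) * ((a.val : ℕ) : ZP p₁ Q)) = 0 ↔ a = ↑u⁻¹ * toQ p₁ Q j := by
    intro a
    rw [map_sub, map_mul, map_natCast, map_natCast, ZMod.natCast_zmod_val, sub_eq_zero, ← hu]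
    constructor
    · intro h; rw [h, ← mul_assoc, Units.inv_mul, one_mul]
    · intro h; rw [h, ← mul_assoc, Units.mul_inv, one_mul]
  have hterm : ∀ a : ZQ Q,
      (ZMod.stdAddChar (-((((p₁ : ℕ) : ZP p₁ Q) * ((a.val : ℕ) : ZP p₁ Q)) ^ 2) : ZP p₁ Q) : ℂ)
          * (if toQ p₁ Q (j - ((p₁ : ℕ) : ZP p₁ Q) * ((a.val : ℕ) : ZP p₁ Q)) = 0
              then (ZMod.stdAddChar (-((j - ((p₁ : ℕ) : ZP p₁ Q) * ((a.val : ℕ) : ZP p₁ Q)) ^ 2) :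
                ZP p₁ Q) : ℂ) else 0)
        = if a = ↑u⁻¹ * toQ p₁ Q j then (ZMod.stdAddChar (-(j ^ 2) : ZP p₁ Q) : ℂ) else 0 := by
    intro a
    by_cases ha : toQ p₁ Q (j - ((p₁ : ℕ) : ZP p₁ Q) * ((a.val : ℕ) : ZP p₁ Q)) = 0
    · rw [if_pos ha, if_pos ((hcond a).1 ha), chirp_recentre p₁ Q _ j ha, ← AddChar.map_add_eq_mul,
        ← AddChar.map_add_eq_mul]
      congr 1
      ring
    · rw [if_neg ha, mul_zero, if_neg (mt (hcond a).2 ha)]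
  simp_rw [hterm]
  rw [Finset.sum_ite_eq' Finset.univ, if_pos (Finset.mem_univ _)]

variable {n D p₁ Q}
variable {U : Finset (Fin (n + 1))} {bk : Fin (n + 1) → ℤ}

/-- **The line ket of a class secret lies in the span of the knowable coset family of any class
secret**: `|φ_{b,v′}⟩ ∈ span {|φ_{b₂,w}⟩ : w ~ v₀}` whenever `v′ ~ v₀` (odd `Q`, `gcd(p₁,Q) = 1`) — by
the sub-line resolution, `InClass.sublineKet_eq` and `sum_conj_chirp_p₁_smul_phi8bKet`.
[cite: ChenQuantumLattice2024, §3.5.9 p. 35, eq. (12) p. 17] -/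
theorem phi8bKet_mem_span_coset (hQ : Odd ((Q : ℕ+) : ℕ)) (hpQ : Nat.Coprime (p₁ : ℕ) (Q : ℕ))
    {b b₂ : Fin (n + 1) → ℤ} (hb : InClass n p₁ U bk b) (hb₂ : InClass n p₁ U bk b₂)
    {v₀ v' : Fin (n + 1) → ℤ} (hv' : SameCoset n D p₁ Q U bk v₀ v') :
    phi8bKet n D p₁ Q b v'
      ∈ Submodule.span ℂ {φ | ∃ w, SameCoset n D p₁ Q U bk v₀ w ∧ φ = phi8bKet n D p₁ Q b₂ w} := by
  rw [phi8bKet_eq_sum_sublineKet n D p₁ Q hpQ b v']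
  refine Submodule.sum_mem _ fun a _ => Submodule.smul_mem _ _ ?_
  set w₁ := lineShift n D b v' (((p₁ : ℕ) : ℤ) * ((a.val : ℕ) : ℤ)) with hw₁
  have hw₁c : SameCoset n D p₁ Q U bk v₀ w₁ := hv'.trans (sameCoset_lineShift_p₁_mul hb v' _)
  rw [InClass.sublineKet_eq n D p₁ Q hb hb₂ w₁]
  have hP0 : ((((p₁ * Q : ℕ+) : ℕ) : ℂ)) ≠ 0 := Nat.cast_ne_zero.2 (PNat.ne_zero _)
  have key : sublineKet n D p₁ Q b₂ w₁ = ((((p₁ * Q : ℕ+) : ℕ) : ℂ))⁻¹ •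
      ∑ t : ZP p₁ Q, (starRingEnd ℂ) (ZMod.stdAddChar (-((((p₁ : ℕ) : ZP p₁ Q) * t) ^ 2) :
          ZP p₁ Q) : ℂ)
        • phi8bKet n D p₁ Q b₂ (lineShift n D b₂ w₁ (-(((((p₁ : ℕ) : ZP p₁ Q) * t).val : ℕ) : ℤ))) := by
    rw [sum_conj_chirp_p₁_smul_phi8bKet n D p₁ Q hQ b₂ w₁, inv_smul_smul₀ hP0]
  rw [key]
  refine Submodule.smul_mem _ _ (Submodule.sum_mem _ fun t _ => Submodule.smul_mem _ _
    (Submodule.subset_span ⟨_, ?_, rfl⟩))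
  refine (hw₁c.trans (sameCoset_lineShift_p₁_mul hb₂ w₁ (-((t.val : ℕ) : ℤ)))).congr fun i =>
    lineShift_cast_eq_of_modEq n D p₁ Q b₂ w₁ ?_ i
  rw [mul_neg]
  exact (val_p₁_mul_modEq t).symm.neg

variable (n D p₁ Q)

/-- THE KNOWABLE COSET FAMILY of a run with true offset `v₀`: for a candidate secret `b`, the line kets
`|φ_{b,w}⟩` of all offsets `w` in the knowable coset of `v₀`. [cite: ChenQuantumLattice2024, Claim 3.14 pp. 33–34, §3.5.9 p. 35] -/
def cosetFamily (U : Finset (Fin (n + 1))) (bk : Fin (n + 1) → ℤ) (v₀ b : Fin (n + 1) → ℤ) :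
    Set (Ket (n + 1) ((D * D * (p₁ * Q) : ℕ+) : ℕ)) :=
  {φ | ∃ w, SameCoset n D p₁ Q U bk v₀ w ∧ φ = phi8bKet n D p₁ Q b w}

/-- The set of class secrets. [cite: ChenQuantumLattice2024, eq. (12) p. 17] -/
def classSecrets (U : Finset (Fin (n + 1))) (bk : Fin (n + 1) → ℤ) : Set (Fin (n + 1) → ℤ) :=
  {b | InClass n p₁ U bk b}

/-- **The single-run knowable family is a knowable family** (odd `P`, odd `Q`, `gcd(p₁,Q) = 1`,
`0 ∉ U ≠ ∅`, `bk₀ = −1`): spans by `phi8bKet_mem_span_coset`, non-vanishing by `phi8bKet_ne_zero`,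
one-scalar property = `IsCosetND.apply_eq_smul`. [cite: ChenQuantumLattice2024, §3.5.9 pp. 34–38, Claim 3.14 pp. 33–34, eq. (12) p. 17] -/
theorem knowableFamily_coset (hP : Odd ((p₁ * Q : ℕ+) : ℕ)) (hQ : Odd ((Q : ℕ+) : ℕ))
    (hpQ : Nat.Coprime (p₁ : ℕ) (Q : ℕ)) {U : Finset (Fin (n + 1))} {bk : Fin (n + 1) → ℤ}
    (hU : (0 : Fin (n + 1)) ∉ U) (hU' : U.Nonempty) (hbk0 : bk 0 = -1) (v₀ : Fin (n + 1) → ℤ) :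
    KnowableFamily (classSecrets n p₁ U bk) (cosetFamily n D p₁ Q U bk v₀) where
  sub_span := by
    rintro b hb b' hb' φ ⟨w, hw, rfl⟩
    exact phi8bKet_mem_span_coset hQ hpQ hb' hb hw
  ne_zero := by
    rintro b hb φ ⟨w, -, rfl⟩
    exact phi8bKet_ne_zero n D p₁ Q b w hP (InClass.apply_zero n p₁ hU hbk0 hb)
  scalar := by
    intro E hE
    have hcos : IsCosetND n D p₁ Q U bk v₀ E := fun b hb w hw => hE b hb _ ⟨w, hw, rfl⟩
    by_cases hS : ∃ b₁, InClass n p₁ U bk b₁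
    · obtain ⟨b₁, hb₁⟩ := hS
      refine ⟨ndValue n D p₁ Q E b₁ v₀, ?_⟩
      rintro b hb φ ⟨w, hw, rfl⟩
      exact hcos.apply_eq_smul hP hQ hpQ hU hU' hbk0 hb₁ hb hw
    · exact ⟨0, fun b hb _ _ => (hS ⟨b, hb⟩).elim⟩

end SingleRun

/-! ### The multi-run theorem -/

section MultiRun

variable (n : ℕ) (D p₁ Q : ℕ+)

/-- THE JOINT STEP-9 INPUT OF `r` RUNS: `⊗ᵢ |φ_{b,wᵢ}⟩`, common secret-dependent direction `b`, one
offset `wᵢ` per run. [cite: ChenQuantumLattice2024, §3.5.9 p. 35] -/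
noncomputable def jointPhiKet (r : ℕ) (b : Fin (n + 1) → ℤ) (w : Fin r → Fin (n + 1) → ℤ) :
    (Fin r → (Fin (n + 1) → ZN D p₁ Q)) → ℂ :=
  jointKet r fun i => phi8bKet n D p₁ Q b (w i)

/-- `(⊗ᵢ |φ_{b,wᵢ}⟩)(x) = ∏ᵢ φ_{b,wᵢ}(xᵢ)`. [folklore] -/
theorem jointPhiKet_apply (r : ℕ) (b : Fin (n + 1) → ℤ) (w : Fin r → Fin (n + 1) → ℤ)
    (x : Fin r → (Fin (n + 1) → ZN D p₁ Q)) :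
    jointPhiKet n D p₁ Q r b w x = ∏ i, phi8bKet n D p₁ Q b (w i) (x i) := rfl

/-- The joint family of the runs' knowable coset families consists of the joint kets `⊗ᵢ|φ_{b,wᵢ}⟩`,
`wᵢ ~ v′ᵢ`. [folklore] -/
theorem mem_jointFamily_coset_iff {r : ℕ} {U : Finset (Fin (n + 1))} {bk : Fin (n + 1) → ℤ}
    (v' : Fin r → Fin (n + 1) → ℤ) (b : Fin (n + 1) → ℤ)
    (Ψ : (Fin r → (Fin (n + 1) → ZN D p₁ Q)) → ℂ) :
    Ψ ∈ jointFamily r (fun i => cosetFamily n D p₁ Q U bk (v' i)) b ↔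
      ∃ w : Fin r → Fin (n + 1) → ℤ, (∀ i, SameCoset n D p₁ Q U bk (v' i) (w i)) ∧
        Ψ = jointPhiKet n D p₁ Q r b w := by
  constructor
  · rintro ⟨φ, hφ, rfl⟩
    choose w hw hφw using hφ
    refine ⟨w, hw, ?_⟩
    have : φ = fun i => phi8bKet n D p₁ Q b (w i) := funext hφw
    rw [this]
    rfl
  · rintro ⟨w, hw, rfl⟩
    exact ⟨fun i => phi8bKet n D p₁ Q b (w i), fun i => ⟨w i, hw i, rfl⟩, rfl⟩

/-- **THE JOINT HYPOTHESIS.**  An operator `E` on the joint register of `r` runs (true offsets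
`v′₁,…,v′_r`) is JOINTLY NON-DEMOLITION: it never destroys the joint state `⊗ᵢ|φ_{b,wᵢ}⟩` of any
instance the algorithm cannot exclude — `b` any class secret (`InClass`: agrees with the public `bk`
off `U`, divisible by `2p₁` on `U`), each `wᵢ` any offset with the same line invariants and Step-8
datum as `v′ᵢ` (`SameCoset`).  Nothing is assumed about the structure of `E` (it may entangle the
runs). [cite: ChenQuantumLattice2024, §3.5.9 pp. 34–38, Claim 3.14 pp. 33–34, eq. (12) p. 17] -/
def IsJointND (r : ℕ) (U : Finset (Fin (n + 1))) (bk : Fin (n + 1) → ℤ)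
    (v' : Fin r → Fin (n + 1) → ℤ)
    (E : ((Fin r → (Fin (n + 1) → ZN D p₁ Q)) → ℂ) →ₗ[ℂ] ((Fin r → (Fin (n + 1) → ZN D p₁ Q)) → ℂ)) :
    Prop :=
  ∀ b, InClass n p₁ U bk b → ∀ w : Fin r → Fin (n + 1) → ℤ,
    (∀ i, SameCoset n D p₁ Q U bk (v' i) (w i)) → IsND E (jointPhiKet n D p₁ Q r b w)

variable {n D p₁ Q}
variable {r : ℕ} {U : Finset (Fin (n + 1))} {bk : Fin (n + 1) → ℤ} {v' : Fin r → Fin (n + 1) → ℤ}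

/-- **T4, MULTI-RUN FORM: entangling the runs buys nothing.**  For odd `P = p₁Q`, odd `Q`,
`gcd(p₁,Q) = 1`, `0 ∉ U ≠ ∅`, `bk₀ = −1`: a jointly non-demolition operator on the registers of `r`
runs acts on the WHOLE joint knowable family as ONE scalar —
`E(⊗ᵢ|φ_{b,wᵢ}⟩) = c·⊗ᵢ|φ_{b,wᵢ}⟩` for every class secret `b` and all `wᵢ ~ v′ᵢ`, with `c`
independent of `b` and of the `wᵢ`. [cite: ChenQuantumLattice2024, §3.5.9 pp. 34–38, Claim 3.14 pp. 33–34, eq. (12) p. 17] -/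
theorem IsJointND.exists_eq_smul
    {E : ((Fin r → (Fin (n + 1) → ZN D p₁ Q)) → ℂ) →ₗ[ℂ] ((Fin r → (Fin (n + 1) → ZN D p₁ Q)) → ℂ)}
    (hE : IsJointND n D p₁ Q r U bk v' E) (hP : Odd ((p₁ * Q : ℕ+) : ℕ)) (hQ : Odd ((Q : ℕ+) : ℕ))
    (hpQ : Nat.Coprime (p₁ : ℕ) (Q : ℕ)) (hU : (0 : Fin (n + 1)) ∉ U) (hU' : U.Nonempty)
    (hbk0 : bk 0 = -1) :
    ∃ c : ℂ, ∀ b, InClass n p₁ U bk b → ∀ w : Fin r → Fin (n + 1) → ℤ,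
      (∀ i, SameCoset n D p₁ Q U bk (v' i) (w i)) →
        E (jointPhiKet n D p₁ Q r b w) = c • jointPhiKet n D p₁ Q r b w := by
  have hK := KnowableFamily.joint r
    (F := fun i => cosetFamily n D p₁ Q U bk (v' i))
    (fun i => knowableFamily_coset n D p₁ Q hP hQ hpQ hU hU' hbk0 (v' i))
  obtain ⟨c, hc⟩ := hK.scalar E fun b hb Ψ hΨ => by
    obtain ⟨w, hw, rfl⟩ := (mem_jointFamily_coset_iff n D p₁ Q v' b Ψ).1 hΨ
    exact hE b hb w hw
  exact ⟨c, fun b hb w hw =>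
    hc b hb _ ((mem_jointFamily_coset_iff n D p₁ Q v' b _).2 ⟨w, hw, rfl⟩)⟩

/-- Hence any two instances of the joint family get the same eigenvalue: an instrument built from
jointly non-demolition operations has an outcome law independent of the instance.
[cite: ChenQuantumLattice2024, §3.5.9 pp. 34–38, Claim 3.14 pp. 33–34] -/
theorem IsJointND.apply_eq_smul_pair
    {E : ((Fin r → (Fin (n + 1) → ZN D p₁ Q)) → ℂ) →ₗ[ℂ] ((Fin r → (Fin (n + 1) → ZN D p₁ Q)) → ℂ)}
    (hE : IsJointND n D p₁ Q r U bk v' E) (hP : Odd ((p₁ * Q : ℕ+) : ℕ)) (hQ : Odd ((Q : ℕ+) : ℕ))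
    (hpQ : Nat.Coprime (p₁ : ℕ) (Q : ℕ)) (hU : (0 : Fin (n + 1)) ∉ U) (hU' : U.Nonempty)
    (hbk0 : bk 0 = -1) {b b' : Fin (n + 1) → ℤ} (hb : InClass n p₁ U bk b)
    (hb' : InClass n p₁ U bk b') {w w' : Fin r → Fin (n + 1) → ℤ}
    (hw : ∀ i, SameCoset n D p₁ Q U bk (v' i) (w i)) (hw' : ∀ i, SameCoset n D p₁ Q U bk (v' i) (w' i)) :
    ∃ c : ℂ, E (jointPhiKet n D p₁ Q r b w) = c • jointPhiKet n D p₁ Q r b w ∧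
      E (jointPhiKet n D p₁ Q r b' w') = c • jointPhiKet n D p₁ Q r b' w' := by
  obtain ⟨c, hc⟩ := hE.exists_eq_smul hP hQ hpQ hU hU' hbk0
  exact ⟨c, hc b hb w hw, hc b' hb' w' hw'⟩

/-- The joint ket of line kets is not zero. [folklore] -/
theorem jointPhiKet_ne_zero (hP : Odd ((p₁ * Q : ℕ+) : ℕ)) {b : Fin (n + 1) → ℤ} (hb : b 0 = -1)
    (w : Fin r → Fin (n + 1) → ℤ) : jointPhiKet n D p₁ Q r b w ≠ 0 := by
  intro h
  have h1 := congr_fun h fun i j => ((w i j : ℤ) : ZN D p₁ Q)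
  rw [jointPhiKet_apply, Pi.zero_apply] at h1
  refine Finset.prod_ne_zero_iff.2 (fun i _ => ?_) h1
  rw [phi8bKet_apply_offset n D p₁ Q b (w i) hP hb]
  exact one_ne_zero

/-- **Non-vacuity and comparison with the single-run theorem**: a single-run coset-non-demolition
operation (at the first run's offset) applied to the FIRST register of the joint state of `r+1` runs is
jointly non-demolition. [cite: ChenQuantumLattice2024, §3.5.9 pp. 34–38] -/
theorem IsCosetND.isJointND_liftFst {v' : Fin (r + 1) → Fin (n + 1) → ℤ}
    {E₁ : Ket (n + 1) ((D * D * (p₁ * Q) : ℕ+) : ℕ) →ₗ[ℂ] Ket (n + 1) ((D * D * (p₁ * Q) : ℕ+) : ℕ)}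
    (hE₁ : IsCosetND n D p₁ Q U bk (v' 0) E₁) :
    IsJointND n D p₁ Q (r + 1) U bk v' (liftFst (splitEquiv r (Fin (n + 1) → ZN D p₁ Q)) E₁) := by
  intro b hb w hw
  have hsplit : jointPhiKet n D p₁ Q (r + 1) b w
      = tmul (splitEquiv r (Fin (n + 1) → ZN D p₁ Q)) (phi8bKet n D p₁ Q b (w 0))
          (jointPhiKet n D p₁ Q r b (Fin.tail w)) := by
    unfold jointPhiKet
    rw [jointKet_succ]
    rfl
  rw [hsplit]
  exact IsND.liftFst _ (hE₁ b hb (w 0) (hw 0)) _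

end MultiRun

/-! ### Adaptive protocols on the joint register -/

section JointAdaptive

variable (n : ℕ) (D p₁ Q : ℕ+)

/-- **A SAFE ADAPTIVE PROTOCOL ON THE JOINT REGISTER of `r` runs**: at every outcome history and for
every branch, the stage operator (any linear map of the joint register — entangling allowed) is
non-demolition on the current joint branch state of every instance `(b; w₁,…,w_r)` of the joint
knowable family that is still consistent with the history. [cite: ChenQuantumLattice2024, §3.5.9 pp. 34–38, Claim 3.14 pp. 33–34] -/
def JointAdaptiveSafe {K : Type*} (r : ℕ) (U : Finset (Fin (n + 1))) (bk : Fin (n + 1) → ℤ)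
    (v' : Fin r → Fin (n + 1) → ℤ)
    (step : List K → K → (((Fin r → (Fin (n + 1) → ZN D p₁ Q)) → ℂ)
      →ₗ[ℂ] ((Fin r → (Fin (n + 1) → ZN D p₁ Q)) → ℂ))) : Prop :=
  ∀ (h : List K) (κ : K) (b : Fin (n + 1) → ℤ) (w : Fin r → Fin (n + 1) → ℤ), InClass n p₁ U bk b →
    (∀ i, SameCoset n D p₁ Q U bk (v' i) (w i)) →
      composedOp step h (jointPhiKet n D p₁ Q r b w) ≠ 0 →
        IsND (step h κ) (composedOp step h (jointPhiKet n D p₁ Q r b w))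

variable {n D p₁ Q}
variable {K : Type*} {r : ℕ} {U : Finset (Fin (n + 1))} {bk : Fin (n + 1) → ℤ}
variable {v' : Fin r → Fin (n + 1) → ℤ}
variable {step : List K → K → (((Fin r → (Fin (n + 1) → ZN D p₁ Q)) → ℂ)
  →ₗ[ℂ] ((Fin r → (Fin (n + 1) → ZN D p₁ Q)) → ℂ))}

/-- A jointly safe protocol is a safe protocol on the joint family (generic form). [folklore] -/
theorem JointAdaptiveSafe.safeOn (hS : JointAdaptiveSafe n D p₁ Q r U bk v' step) :
    SafeOn (famUnion (classSecrets n p₁ U bk) (jointFamily r fun i => cosetFamily n D p₁ Q U bk (v' i)))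
      step := by
  rintro h κ Ψ ⟨b, hb, hΨ⟩ hne
  obtain ⟨w, hw, rfl⟩ := (mem_jointFamily_coset_iff n D p₁ Q v' b Ψ).1 hΨ
  exact hS h κ b w hb hw hne

/-- Non-vacuity: every protocol all of whose stage operators are jointly non-demolition (entangling or
not) is jointly safe. [cite: ChenQuantumLattice2024, §3.5.9 pp. 34–38] -/
theorem JointAdaptiveSafe.of_forall_isJointND (hP : Odd ((p₁ * Q : ℕ+) : ℕ))
    (hQ : Odd ((Q : ℕ+) : ℕ)) (hpQ : Nat.Coprime (p₁ : ℕ) (Q : ℕ)) (hU : (0 : Fin (n + 1)) ∉ U)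
    (hU' : U.Nonempty) (hbk0 : bk 0 = -1)
    (h : ∀ hist κ, IsJointND n D p₁ Q r U bk v' (step hist κ)) :
    JointAdaptiveSafe n D p₁ Q r U bk v' step := by
  intro hist κ b w hb hw _
  have hK := KnowableFamily.joint r
    (F := fun i => cosetFamily n D p₁ Q U bk (v' i))
    (fun i => knowableFamily_coset n D p₁ Q hP hQ hpQ hU hU' hbk0 (v' i))
  obtain ⟨c, hc⟩ := exists_eq_smul_of_forall_isND hK.oneScalarOn (fun hist κ Ψ hΨ' => by
    obtain ⟨b', hb', hΨ⟩ := hΨ'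
    obtain ⟨w', hw', rfl⟩ := (mem_jointFamily_coset_iff n D p₁ Q v' b' Ψ).1 hΨ
    exact h hist κ b' hb' w' hw') hist
  rw [hc _ ⟨b, hb, (mem_jointFamily_coset_iff n D p₁ Q v' b _).2 ⟨w, hw, rfl⟩⟩]
  exact (h hist κ b hb w hw).smul c

/-- **T4, adaptive multi-run form.**  For odd `P`, odd `Q`, `gcd(p₁,Q) = 1`, `0 ∉ U ≠ ∅`, `bk₀ = −1`:
along a jointly safe adaptive protocol every composed branch acts on the whole joint knowable family
as ONE scalar `c(h)`. [cite: ChenQuantumLattice2024, §3.5.9 pp. 34–38, Claim 3.14 pp. 33–34, eq. (12) p. 17] -/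
theorem JointAdaptiveSafe.exists_eq_smul (hS : JointAdaptiveSafe n D p₁ Q r U bk v' step)
    (hP : Odd ((p₁ * Q : ℕ+) : ℕ)) (hQ : Odd ((Q : ℕ+) : ℕ)) (hpQ : Nat.Coprime (p₁ : ℕ) (Q : ℕ))
    (hU : (0 : Fin (n + 1)) ∉ U) (hU' : U.Nonempty) (hbk0 : bk 0 = -1) (h : List K) :
    ∃ c : ℂ, ∀ b w, InClass n p₁ U bk b → (∀ i, SameCoset n D p₁ Q U bk (v' i) (w i)) →
      composedOp step h (jointPhiKet n D p₁ Q r b w) = c • jointPhiKet n D p₁ Q r b w := by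
  have hK := KnowableFamily.joint r
    (F := fun i => cosetFamily n D p₁ Q U bk (v' i))
    (fun i => knowableFamily_coset n D p₁ Q hP hQ hpQ hU hU' hbk0 (v' i))
  obtain ⟨c, hc⟩ := hS.safeOn.exists_eq_smul hK.oneScalarOn hK.ne_zero_union h
  exact ⟨c, fun b w hb hw =>
    hc _ ⟨b, hb, (mem_jointFamily_coset_iff n D p₁ Q v' b _).2 ⟨w, hw, rfl⟩⟩⟩

/-- **The joint knowable family never shrinks** along a jointly safe adaptive protocol.
[cite: ChenQuantumLattice2024, §3.5.9 pp. 34–38, Claim 3.14 pp. 33–34] -/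
theorem JointAdaptiveSafe.alive_all_or_none (hS : JointAdaptiveSafe n D p₁ Q r U bk v' step)
    (hP : Odd ((p₁ * Q : ℕ+) : ℕ)) (hQ : Odd ((Q : ℕ+) : ℕ)) (hpQ : Nat.Coprime (p₁ : ℕ) (Q : ℕ))
    (hU : (0 : Fin (n + 1)) ∉ U) (hU' : U.Nonempty) (hbk0 : bk 0 = -1) (h : List K) :
    (∀ b w, InClass n p₁ U bk b → (∀ i, SameCoset n D p₁ Q U bk (v' i) (w i)) →
        composedOp step h (jointPhiKet n D p₁ Q r b w) ≠ 0) ∨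
      (∀ b w, InClass n p₁ U bk b → (∀ i, SameCoset n D p₁ Q U bk (v' i) (w i)) →
        composedOp step h (jointPhiKet n D p₁ Q r b w) = 0) := by
  obtain ⟨c, hc⟩ := hS.exists_eq_smul hP hQ hpQ hU hU' hbk0 h
  by_cases hc0 : c = 0
  · exact Or.inr fun b w hb hw => by rw [hc b w hb hw, hc0, zero_smul]
  · exact Or.inl fun b w hb hw => by
      rw [hc b w hb hw]
      exact smul_ne_zero_of_ne_zero hc0
        (jointPhiKet_ne_zero hP (InClass.apply_zero n p₁ hU hbk0 hb) w)

/-- **The transcript law of a jointly safe adaptive protocol is instance-blind**: every history has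
the same Born weight `‖c(h)‖²` on every instance of the joint knowable family — it reveals nothing
about the secret's unknown coordinates nor about the positions of the `r` offsets in their knowable
cosets. [cite: ChenQuantumLattice2024, §3.5.9 pp. 34–38, Claim 3.14 pp. 33–34, eq. (12) p. 17] -/
theorem JointAdaptiveSafe.histWeight_indep (hS : JointAdaptiveSafe n D p₁ Q r U bk v' step)
    (hP : Odd ((p₁ * Q : ℕ+) : ℕ)) (hQ : Odd ((Q : ℕ+) : ℕ)) (hpQ : Nat.Coprime (p₁ : ℕ) (Q : ℕ))
    (hU : (0 : Fin (n + 1)) ∉ U) (hU' : U.Nonempty) (hbk0 : bk 0 = -1) (h : List K)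
    {b b' : Fin (n + 1) → ℤ} (hb : InClass n p₁ U bk b) (hb' : InClass n p₁ U bk b')
    {w w' : Fin r → Fin (n + 1) → ℤ} (hw : ∀ i, SameCoset n D p₁ Q U bk (v' i) (w i))
    (hw' : ∀ i, SameCoset n D p₁ Q U bk (v' i) (w' i)) :
    histWeight step h (jointPhiKet n D p₁ Q r b w) = histWeight step h (jointPhiKet n D p₁ Q r b' w') := by
  obtain ⟨c, hc⟩ := hS.exists_eq_smul hP hQ hpQ hU hU' hbk0 h
  rw [histWeight_eq_of_eq_smul (hc b w hb hw)
      (jointPhiKet_ne_zero hP (InClass.apply_zero n p₁ hU hbk0 hb) w),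
    histWeight_eq_of_eq_smul (hc b' w' hb' hw')
      (jointPhiKet_ne_zero hP (InClass.apply_zero n p₁ hU hbk0 hb') w')]

end JointAdaptive

end Literature.Computability.Cryptography.Chen2024

/-! ### Applied to an admissible shape -/

namespace Literature.Computability.Cryptography.Chen2024.Shape

open scoped BigOperators

variable (S : Shape)

/-- **T4, multi-run form, for Chen's shapes.**  `S` admissible (Cond. C.3), `U` a non-empty set of
unknown coordinates with `0 ∉ U`, `bk` public and equal to `S.b` off `U`, `r` runs with true offsets
`v′₁,…,v′_r`, `b₂` any class secret, `wᵢ` any offsets in the knowable cosets of the `v′ᵢ`: a jointly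
non-demolition operator on the `r` registers has the same eigenvalue on the true joint state
`⊗ᵢ|φ_{S.b,v′ᵢ}⟩` and on `⊗ᵢ|φ_{b₂,wᵢ}⟩`. [cite: ChenQuantumLattice2024, §3.5.9 pp. 34–38, Claim 3.14 pp. 33–34, eq. (12) p. 17, Cond. C.3 p. 18] -/
theorem jointND_blind (h : S.Admissible) (U : Finset (Fin (S.n + 1)))
    (hU : (0 : Fin (S.n + 1)) ∉ U) (hU' : U.Nonempty) (bk b₂ : Fin (S.n + 1) → ℤ)
    (hbk : ∀ i, i ∉ U → bk i = S.b i) (hb₂ : ∀ i, i ∉ U → b₂ i = S.b i)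
    (hb₂U : ∀ i ∈ U, (2 * (S.p₁ : ℤ)) ∣ b₂ i) {r : ℕ} (v' : Fin r → Fin (S.n + 1) → ℤ)
    (E : ((Fin r → (Fin (S.n + 1) → ZN S.D S.p₁ S.Q)) → ℂ)
      →ₗ[ℂ] ((Fin r → (Fin (S.n + 1) → ZN S.D S.p₁ S.Q)) → ℂ))
    (hE : IsJointND S.n S.D S.p₁ S.Q r U bk v' E) {w : Fin r → Fin (S.n + 1) → ℤ}
    (hw : ∀ i, SameCoset S.n S.D S.p₁ S.Q U bk (v' i) (w i)) :
    ∃ c : ℂ, E (jointPhiKet S.n S.D S.p₁ S.Q r S.b v') = c • jointPhiKet S.n S.D S.p₁ S.Q r S.b v' ∧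
      E (jointPhiKet S.n S.D S.p₁ S.Q r b₂ w) = c • jointPhiKet S.n S.D S.p₁ S.Q r b₂ w := by
  have hbk0 : bk 0 = -1 := by rw [hbk 0 hU, h.b_head]
  have hSb : InClass S.n S.p₁ U bk S.b :=
    ⟨fun i hi => (hbk i hi).symm, fun i hi => h.b_tail i (fun h0 => hU (h0 ▸ hi))⟩
  have hb₂' : InClass S.n S.p₁ U bk b₂ :=
    ⟨fun i hi => (hb₂ i hi).trans (hbk i hi).symm, fun i hi => hb₂U i hi⟩
  exact hE.apply_eq_smul_pair h.odd_P h.odd_Q h.cop_pQ hU hU' hbk0 hSb hb₂'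
    (fun i => sameCoset_refl (v' i)) hw

/-- **T4, adaptive multi-run form, for Chen's shapes**: every outcome history of a jointly safe
adaptive protocol on the registers of `r` runs has the same Born weight on the true joint state and on
the joint state of any other instance of the joint knowable family. [cite: ChenQuantumLattice2024, §3.5.9 pp. 34–38, Claim 3.14 pp. 33–34, eq. (12) p. 17, Cond. C.3 p. 18] -/
theorem joint_histWeight_blind (h : S.Admissible) (U : Finset (Fin (S.n + 1)))
    (hU : (0 : Fin (S.n + 1)) ∉ U) (hU' : U.Nonempty) (bk b₂ : Fin (S.n + 1) → ℤ)
    (hbk : ∀ i, i ∉ U → bk i = S.b i) (hb₂ : ∀ i, i ∉ U → b₂ i = S.b i)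
    (hb₂U : ∀ i ∈ U, (2 * (S.p₁ : ℤ)) ∣ b₂ i) {K : Type*} {r : ℕ}
    (v' : Fin r → Fin (S.n + 1) → ℤ)
    (step : List K → K → (((Fin r → (Fin (S.n + 1) → ZN S.D S.p₁ S.Q)) → ℂ)
      →ₗ[ℂ] ((Fin r → (Fin (S.n + 1) → ZN S.D S.p₁ S.Q)) → ℂ)))
    (hS : JointAdaptiveSafe S.n S.D S.p₁ S.Q r U bk v' step) {w : Fin r → Fin (S.n + 1) → ℤ}
    (hw : ∀ i, SameCoset S.n S.D S.p₁ S.Q U bk (v' i) (w i)) (hist : List K) :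
    histWeight step hist (jointPhiKet S.n S.D S.p₁ S.Q r b₂ w)
      = histWeight step hist (jointPhiKet S.n S.D S.p₁ S.Q r S.b v') := by
  have hbk0 : bk 0 = -1 := by rw [hbk 0 hU, h.b_head]
  have hSb : InClass S.n S.p₁ U bk S.b :=
    ⟨fun i hi => (hbk i hi).symm, fun i hi => h.b_tail i (fun h0 => hU (h0 ▸ hi))⟩
  have hb₂' : InClass S.n S.p₁ U bk b₂ :=
    ⟨fun i hi => (hb₂ i hi).trans (hbk i hi).symm, fun i hi => hb₂U i hi⟩
  exact hS.histWeight_indep h.odd_P h.odd_Q h.cop_pQ hU hU' hbk0 hist hb₂' hSb hw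
    (fun i => sameCoset_refl (v' i))

end Literature.Computability.Cryptography.Chen2024.Shape
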